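import Summits.MatrixMultiplication.MatrixMultiplication.Theses.FourierTwoFamiliesModP
import Summits.MatrixMultiplication.MatrixMultiplication.Theorems.FourierTwoFamiliesModPPrimeCyclicPowerGainStubFamilyPoint
import Summits.MatrixMultiplication.MatrixMultiplication.Theorems.FourierTwoFamiliesModPPrimeCyclicPowerGainStubAverage
import Summits.MatrixMultiplication.MatrixMultiplication.Theorems.FourierTwoFamiliesModPPrimeCyclicPowerGainThetaPrelim
import Summits.MatrixMultiplication.MatrixMultiplication.Theorems.FourierTwoFamiliesModPPrimeCyclicPowerGainThetaHalfDensity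
import Summits.MatrixMultiplication.MatrixMultiplication.Theorems.FourierTwoFamiliesModPPrimeCyclicPowerGainThetaFrequencyBias
import Summits.MatrixMultiplication.MatrixMultiplication.Theorems.FourierTwoFamiliesModPPrimeLogDecayStubThetaDegreeOne
import Summits.MatrixMultiplication.MatrixMultiplication.Theorems.FourierTwoFamiliesModPPrimeLogDecayStubIntervalCoverage
import Summits.MatrixMultiplication.MatrixMultiplication.Theorems.FourierTwoFamiliesModPPrimeLogDecayStubThetaRectangleCover
import Summits.MatrixMultiplication.MatrixMultiplication.Theorems.PrimeLogDecay.Negative.LoadBearing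

/-!
# Line `fixed-delta-theta-certificate` — skeleton for crux `PrimeLogDecay`
(stmt-MatrixMultiplication-14310, route FourierTwoFamiliesModP; crux-plan round 1,
planner-cruxplan-stmt-MatrixMultiplication-14310-fixed-delta-theta-ce-0, 2026-08-16)

**Idea (card `Cruxes/PrimeLogDecay/Ideas/fixed-delta-theta-certificate.md`, triage r1: pass ×3).**
Freeze the matched-difference set `X₀ = Δ = ⋃ⱼ (A j − B j)`.  Clause (X) becomes PAIRWISE
(`(A i − B k) ∩ Δ = ∅` for `i ≠ k`), so a balanced SDPP family is a set of pairwise COMPATIBLE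
admissible vertices `v = (A, B)` (`|A| = |B| = s`, (W), `A − B ⊆ X₀`) of the `ℤ/p`-invariant
compatibility graph `G_{X₀}`, and `n ≤` the value of its Schrijver–Lovász theta body: every
"feasible kernel" `B` (symmetric, PSD as a real quadratic form, entrywise `≥ 0`, diagonally
dominant, trace `1`, supported on admissible × admissible pairs that are equal or compatible) has
`Σ_{v,w} B v w ≤ T` ⇒ `n ≤ T`.  This OBJECT is shared with the sibling crux 14309's picked line
`clique-coclique-direct-sum-clique` (TRIAGE r1-3), whose landed theorems this file IMPORTS and uses
as glue (`FamilyPoint.stub_familyPoint` p73363 = `α ≤ ϑ⁺`; `Average.stub_average` p73777 =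
symmetrisation; `HalfDensity.two_mul_sq_mul_value_le` p75644 = the route's `L²` level inside the
relaxation).  What is specific to THIS crux is the LOG-LEVEL target and the DEGREE-ONE INTERFACE:

* `stub_thetaDegreeOne` (provable now, size L) — the card's `DegreeOneCertificate` lifted to the
  theta body: for every real test function `F ≤ 1` on `X₀`, `≤ 0` off `X₀`, with nontrivial
  character sums `≤ M`, every feasible kernel of value `X` obeys
  `s·X·ΣF ≤ s|G| + M(|G| − sX)` (i.e. `ρ ΣF − (1 − ρ) M ≤ s`, `ρ = sX/|G|` the fractional density).
  It is the master degree-one lemma: `F = Δ_B` (the trace-weighted matched-difference function),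
  `M = s²` is `ϑ`-HalfDensity (landed), `F = Δ_B` with general `M` is `ϑ`-CommonFrequencyBias
  (= `stub_thetaFrequencyBias`), and ANY certificate `F` of quality `(log s)^c` closes the UNIFORM
  branch below.
* `stub_thetaFrequencyBias` (provable now, size L; verbatim the sibling's registered milestone 6, one
  proof serves both lines) — a kernel beating the wall forces a bias of `Δ_B` at ONE nontrivial
  frequency: `s²(s²X − |G|) ≤ M(|G|s − s²X)`.
* `stub_thetaLogBoundNoCert` — THE BET (open, size X): for every frozen `X₀ ⊆ ℤ/p` WITHOUT a
  degree-one certificate of quality `(log s)^c` (every `F ≤ 1` on `X₀`, `≤ 0` off, with nontrivial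
  character sums `≤ M`, has `ΣF < (s + M)(log s)^c` — the scalar Delsarte LP of `X₀` is weak; this
  is the STRUCTURED branch: `1_{X₀}` and every kernel's `Δ_B` are `(log s)^{-c}`-biased), every
  translation-invariant feasible kernel, handed the `ϑ`-FrequencyBias inequality for its own `Δ_B`,
  has `s (log s)^c · Σ B ≤ p`, i.e. fractional density `≤ (log s)^{-c}`.  Equivalently
  `ϑ⁺(G_{X₀}) ≤ p·s^{-1}(log s)^{-c}` on the structured branch — the card's Transfer `C⁺` restricted,
  as TRIAGE r1-1 asked, to where degree one fails ("what the SDP must add over the LP").  It is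
  implied by the sibling's `stub_thetaBound` (`p·s^{-1-c}`) and survives a polynomial detachment
  `ϑ⁺/α ≤ s^{1-o(1)}` that would kill that one.

**Composition** (`PrimeLogDecay_of`, kernel-checked, `sorry` only inside the three stubs): get
`c, s₀` from the bet; given a balanced SDPP family with `s ≥ max s₀ 2`, put `X₀ := Δ`,
`T := p/(s (log s)^c)`.  Every invariant feasible kernel has `Σ B ≤ T`: EITHER a certificate `F, M`
with `(s+M)(log s)^c ≤ ΣF` exists, and `stub_thetaDegreeOne` gives `sX·ΣF ≤ (s+M)p`, hence
`s(log s)^c X ≤ p`; OR none exists and `stub_thetaLogBoundNoCert` (fed by `stub_thetaFrequencyBias`)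
gives the same.  Then `stub_average` removes invariance, the family is an `n`-set of pairwise
compatible admissible vertices (`cross_disjoint`, `blocks_injective`, `support_vadd_iff`, proved
here), and `stub_familyPoint` gives `n ≤ T`, i.e. `n·s·(log s)^c ≤ p`.

**Disproof used** (`Theorems/PrimeLogDecay/Negative/LoadBearing.lean`, imported; `Disproof.lean`
v3 itself lives under `run/gate/evidence`, not mounted — its notes on the item were read):
`primeLogDecay_false_without_W` — (W) is in admissibility (it makes `Δ_B ≤ 1` and is used by both
provable stubs through `|A − B| = s²`); `primeLogDecay_false_without_X` — (X) IS compatibility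
(`cross_disjoint`); `not_primeLogDecayWith_13_3` / `card_translateClass_mul_le` — translates are ONE
shape, value `≤ p/s²` (landed `ShapeCount`), far inside the bet; chain menus (`ChainMenuDesign`) have
density `s^{-0.585}`, inside every `(log s)^{-c}`.  No stub asserts the refuted wall `n s² ≤ C p`
(p69024): the bet's threshold `p/(s(log s)^c)` is above every known design and kernel.
-/

namespace Summit.MatrixMultiplication.MatrixMultiplication.Cruxes.PrimeLogDecay.FixedDeltaThetaCertificate

open Finset
open scoped Pointwise BigOperators
open Summit.MatrixMultiplication.MatrixMultiplication.Theses.FourierTwoFamiliesModP (PrimeLogDecay)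
open Summit.MatrixMultiplication.MatrixMultiplication.Theorems.PrimeCyclicPowerGainTheta

/-! ## Registered stubs -/

/-- **stub_thetaDegreeOne** (provable now, size L; the card's `DegreeOneCertificate` in the theta
body = scalar Delsarte certificates for the frozen set).  `G` finite abelian, `s ≥ 1`, `X₀ ⊆ G`, a
symmetric PSD entrywise-nonnegative trace-one kernel `B` on block pairs supported on admissible ×
admissible pairs that are equal or compatible (the bet's support hypothesis verbatim), a real test
function `F` with `F ≤ 1` on `X₀` and `F ≤ 0` off `X₀`, and `M ≥ 0` bounding its NONTRIVIAL
character sums.  Then, with `X = Σ_{v,w} B v w`,  `s·X·(Σ_x F x) ≤ s·|G| + M·(|G| − s·X)`.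
Proof sketch: `Φ := Σ_{v,w} B_vw Σ_{a∈v.1,b∈w.2} F(a − b)` is `≤ s²` (diagonal terms: `s²` values
`F ≤ 1` on `v.1 − v.2 ⊆ X₀`; off-diagonal support pairs are compatible, so `a − b ∉ X₀`, `F ≤ 0`,
and `B_vw ≥ 0`); and `Φ ≥ s²X(ΣF)/|G| − M(s − s²X/|G|)`: split `1_{v.1} = s/|G| + f̃_v`,
`1_{w.2} = s/|G| + g̃_w` (tree `Fluct.fluctA_energy/fluctB_energy`: `Σ B_vw⟨f̃_v,f̃_w⟩ = s − s²X/|G|`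
because compatible blocks have DISJOINT sides), the mixed terms vanish, and the fluctuation term
`Σ_{v,w} B_vw ⟨f̃_v, θ ∗ g̃_w⟩` (`θ = F −` mean, `θ̂ = F̂` off the trivial character, `θ̂(1) = 0`) is
`≥ −(λP_A + λ⁻¹M²P_B)/2` by PSD polarisation (`Kernel.neg_add_le_two_mul_cross_of_psd`) and
Plancherel (`‖θ ∗ ·‖` contracts `B`-energy by `max|θ̂|²`, the sibling's milestone
`stub_thetaConvolutionBound`); take `λ = M`.  Specialisations: `F = Δ_B, M = s²` is
`HalfDensity.two_mul_sq_mul_value_le`; `F = Δ_B` is `stub_thetaFrequencyBias`. -/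
theorem stub_thetaDegreeOne :
    ∀ (G : Type) [AddCommGroup G] [Fintype G] [DecidableEq G] (s : ℕ), 1 ≤ s →
      ∀ (X₀ : Finset G) (B : Finset G × Finset G → Finset G × Finset G → ℝ) (F : G → ℝ) (M : ℝ),
      (∀ v w, B v w = B w v) →
      (∀ x : Finset G × Finset G → ℝ, 0 ≤ ∑ v, ∑ w, x v * B v w * x w) →
      (∀ v w, 0 ≤ B v w) →
      (∀ v w : Finset G × Finset G, B v w ≠ 0 →
        (v.1.card = s ∧ v.2.card = s ∧
          (∀ a ∈ v.1, ∀ a' ∈ v.1, ∀ b ∈ v.2, ∀ b' ∈ v.2, (a - a') + (b - b') = 0 → a = a' ∧ b = b') ∧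
          v.1 - v.2 ⊆ X₀) ∧
        (w.1.card = s ∧ w.2.card = s ∧
          (∀ a ∈ w.1, ∀ a' ∈ w.1, ∀ b ∈ w.2, ∀ b' ∈ w.2, (a - a') + (b - b') = 0 → a = a' ∧ b = b') ∧
          w.1 - w.2 ⊆ X₀) ∧
        (v = w ∨ (Disjoint (v.1 - w.2) X₀ ∧ Disjoint (w.1 - v.2) X₀))) →
      ∑ v, B v v = 1 →
      0 ≤ M →
      (∀ x ∈ X₀, F x ≤ 1) →
      (∀ x, x ∉ X₀ → F x ≤ 0) →
      (∀ ψ : AddChar G ℂ, ψ ≠ 1 → ‖∑ x, (F x : ℂ) * ψ x‖ ≤ M) →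
      (s : ℝ) * (∑ v, ∑ w, B v w) * (∑ x, F x) ≤
        (s : ℝ) * (Fintype.card G : ℝ) + M * ((Fintype.card G : ℝ) - (s : ℝ) * ∑ v, ∑ w, B v w) := by
  exact _root_.Summit.MatrixMultiplication.MatrixMultiplication.Theorems.PrimeLogDecayTheta.DegreeOne.stub_thetaDegreeOne

/-- **stub_thetaFrequencyBias** (provable now, size L; VERBATIM the registered milestone
`stub_thetaFrequencyBias` of the sibling line `Cruxes/PrimeCyclicPowerGain/Lines/clique-coclique-direct-sum-clique.lean`
— one proof closes both; it is also the case `F = Δ_B` of `stub_thetaDegreeOne`).  Finite abelian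
`G`, `s ≥ 1`, a symmetric PSD trace-one kernel with the bet's support hypothesis verbatim, value
`X = Σ B`, and `M ≥ 0` bounding the NONTRIVIAL character sums of the trace-weighted matched-difference
function `Δ_B = Σ_v B v v · 1_{v.1} ∗ 1_{−v.2}` (`Δ̂_B(ψ) = Σ_v B v v Σ_{a ∈ v.1} Σ_{b ∈ v.2} ψ(a − b)`).
Then `s² (s² X − |G|) ≤ M (|G| s − s² X)`: beating the wall `|G|/s²` by the factor `E = s²X/|G|`
forces relative bias `M/s² ≥ (E − 1)/(s − E)` at ONE nontrivial frequency (for an actual family this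
is the route's support `CommonFrequencyBias`; `M = s²` recovers `ϑ`-HalfDensity). -/
theorem stub_thetaFrequencyBias :
    ∀ (G : Type) [AddCommGroup G] [Fintype G] [DecidableEq G] (s : ℕ), 1 ≤ s →
      ∀ (X₀ : Finset G) (B : Finset G × Finset G → Finset G × Finset G → ℝ) (M : ℝ),
      (∀ v w, B v w = B w v) →
      (∀ x : Finset G × Finset G → ℝ, 0 ≤ ∑ v, ∑ w, x v * B v w * x w) →
      (∀ v w : Finset G × Finset G, B v w ≠ 0 →
        (v.1.card = s ∧ v.2.card = s ∧
          (∀ a ∈ v.1, ∀ a' ∈ v.1, ∀ b ∈ v.2, ∀ b' ∈ v.2, (a - a') + (b - b') = 0 → a = a' ∧ b = b') ∧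
          v.1 - v.2 ⊆ X₀) ∧
        (w.1.card = s ∧ w.2.card = s ∧
          (∀ a ∈ w.1, ∀ a' ∈ w.1, ∀ b ∈ w.2, ∀ b' ∈ w.2, (a - a') + (b - b') = 0 → a = a' ∧ b = b') ∧
          w.1 - w.2 ⊆ X₀) ∧
        (v = w ∨ (Disjoint (v.1 - w.2) X₀ ∧ Disjoint (w.1 - v.2) X₀))) →
      ∑ v, B v v = 1 →
      0 ≤ M →
      (∀ ψ : AddChar G ℂ, ψ ≠ 1 →
        ‖∑ v, (B v v : ℂ) * ∑ a ∈ v.1, ∑ b ∈ v.2, ψ (a - b)‖ ≤ M) →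
      (s : ℝ) ^ 2 * ((s : ℝ) ^ 2 * (∑ v, ∑ w, B v w) - (Fintype.card G : ℝ)) ≤
        M * ((Fintype.card G : ℝ) * (s : ℝ) - (s : ℝ) ^ 2 * ∑ v, ∑ w, B v w) := by
  exact FrequencyBias.stub_thetaFrequencyBias

/-- **stub_thetaLogBoundNoCert** — THE BET (open; the line's content, size X): the theta body of
the frozen-difference compatibility graph improves HalfDensity by a power of `log s` exactly where
SCALAR (degree-one, Delsarte-type) certificates fail.  For every prime `p`, `s ≥ s₀` and every
frozen `X₀ ⊆ ℤ/p` WITHOUT a degree-one certificate of quality `(log s)^c` at level `s` — i.e. every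
real test function `F ≤ 1` on `X₀`, `≤ 0` off `X₀`, whose nontrivial character sums are `≤ M`, has
`Σ F < (s + M)(log s)^c` (with `F = 1_{X₀}`: some nontrivial Fourier coefficient of `1_{X₀}` exceeds
`|X₀|(log s)^{-c} − s`; with `F = Δ_B`: every feasible kernel's matched-difference function is
`(log s)^{-c}`-biased; Fourier-uniform and thin-random `X₀` are thereby excluded, while arcs, Bohr
sets, cubes, tiles `A − B` and every set of small doubling are included; by finite LP duality the
hypothesis says `X₀` is, up to `O(s/η)` points, inside a level set `{g ≥ η/2}` of a real trigonometric
polynomial `g` with nontrivial frequencies, coefficient `ℓ¹`-norm `≤ 1` and `sup g ≤ η = (log s)^{-c}`)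
— every translation-INVARIANT feasible kernel `B` (symmetric, PSD, `≥ 0`, `B v w ≤ B v v`, trace `1`,
supported on admissible-compatible pairs: the sibling's `stub_thetaBound` hypotheses verbatim), which
moreover satisfies the `ϑ`-FrequencyBias inequality for its own `Δ_B` (hypothesis schema, discharged
in the composition by `stub_thetaFrequencyBias`), has `s · (log s)^c · Σ_{v,w} B v w ≤ p` — fractional
density `sX/p ≤ (log s)^{-c}`.  Equivalently: `ϑ⁺(G_{X₀}) ≤ p·s^{-1}(log s)^{-c}` for every such `X₀`
(the card's Transfer `C⁺`, restricted to the structured branch as TRIAGE r1-1 asked; the transfer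
`C⁺ → crux` is PROVED below, not a stub).  Known: `sX/p ≤ (s+1)/(2s)` always (`ϑ`-HalfDensity,
landed), `≤ K/s` for kernels carried by `K` shapes (landed `ShapeCount`), `≲ 2/s` on intervals and
`≤ s^{-0.17}` on box/digit worlds (drefute F2 on the sibling: rectangle cliques, landed
`Rectangle`/`CliqueCover`); no frozen set with fractional density above `s^{-0.17+o(1)}` is known, and
the sibling's `stub_thetaBound` (`p·s^{-1-c}`) implies this stub outright.  Why it might fail: a
Feige-type phenomenon — `ℤ/p`-invariant compatibility graphs on the shapes of one structured `X₀`
that are theta-almost-edgeless (`ϑ ≥ n^{1-o(1)}`) yet far from independent (drefute F4): the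
relaxation, not the crux, would break; the log threshold tolerates `ϑ⁺/α` up to `s^{1-o(1)}`. -/
theorem stub_thetaLogBoundNoCert :
    ∃ c : ℝ, 0 < c ∧ ∃ s₀ : ℕ, ∀ (p : ℕ) [Fact p.Prime] (s : ℕ), s₀ ≤ s →
      ∀ X₀ : Finset (ZMod p),
      (∀ (F : ZMod p → ℝ) (M : ℝ), 0 ≤ M → (∀ x ∈ X₀, F x ≤ 1) → (∀ x, x ∉ X₀ → F x ≤ 0) →
          (∀ ψ : AddChar (ZMod p) ℂ, ψ ≠ 1 → ‖∑ x, (F x : ℂ) * ψ x‖ ≤ M) →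
          ∑ x, F x < ((s : ℝ) + M) * Real.log (s : ℝ) ^ c) →
      ∀ B : Finset (ZMod p) × Finset (ZMod p) → Finset (ZMod p) × Finset (ZMod p) → ℝ,
        (∀ (t : ZMod p) (v w : Finset (ZMod p) × Finset (ZMod p)), B (t +ᵥ v) (t +ᵥ w) = B v w) →
        (∀ v w, B v w = B w v) →
        (∀ x : Finset (ZMod p) × Finset (ZMod p) → ℝ, 0 ≤ ∑ v, ∑ w, x v * B v w * x w) →
        (∀ v w, 0 ≤ B v w) →
        (∀ v w, B v w ≤ B v v) →
        (∀ v w : Finset (ZMod p) × Finset (ZMod p), B v w ≠ 0 →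
            (v.1.card = s ∧ v.2.card = s ∧
              (∀ a ∈ v.1, ∀ a' ∈ v.1, ∀ b ∈ v.2, ∀ b' ∈ v.2,
                  (a - a') + (b - b') = 0 → a = a' ∧ b = b') ∧
              v.1 - v.2 ⊆ X₀) ∧
            (w.1.card = s ∧ w.2.card = s ∧
              (∀ a ∈ w.1, ∀ a' ∈ w.1, ∀ b ∈ w.2, ∀ b' ∈ w.2,
                  (a - a') + (b - b') = 0 → a = a' ∧ b = b') ∧
              w.1 - w.2 ⊆ X₀) ∧
            (v = w ∨ (Disjoint (v.1 - w.2) X₀ ∧ Disjoint (w.1 - v.2) X₀))) →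
        ∑ v, B v v = 1 →
        (∀ M : ℝ, 0 ≤ M →
          (∀ ψ : AddChar (ZMod p) ℂ, ψ ≠ 1 →
            ‖∑ v, (B v v : ℂ) * ∑ a ∈ v.1, ∑ b ∈ v.2, ψ (a - b)‖ ≤ M) →
          (s : ℝ) ^ 2 * ((s : ℝ) ^ 2 * (∑ v, ∑ w, B v w) - (p : ℝ)) ≤
            M * ((p : ℝ) * (s : ℝ) - (s : ℝ) ^ 2 * ∑ v, ∑ w, B v w)) →
        (s : ℝ) * Real.log (s : ℝ) ^ c * ∑ v, ∑ w, B v w ≤ (p : ℝ) := by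
  sorry

/-! ## Registered MILESTONE stubs of the bet (provable now; NOT used by `PrimeLogDecay_of`)

The bet asks for `ϑ⁺(G_{X₀}) ≤ p · s⁻¹ (log s)^{-c}` on the structured branch.  The three milestones
below settle its first structured family — INTERVALS `X₀ = {0, …, L−1} ⊆ ℤ/p` (drefute F2 on the
sibling crux stmt-14309 found `ϑ ≲ 2p/L` numerically via rectangle cliques; nothing was in Lean).
Mechanism (lead, cycle 1): ONE rectangle `P − Q ⊆ X₀` gives the `|G|` translated rectangle cliques
`C_t = {v : v.1 ∩ (t + P) ≠ ∅ ∧ v.2 ∩ (t + Q) ≠ ∅}` (landed `Rectangle.entry_eq_zero_of_rectangle`);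
if every vertex of the diagonal support lies in between `m` and `M` of them, the landed fractional
clique-cover bound (`CliqueCover.value_le_of_cliqueCover`, weights `1/m`, multiplicity `≤ M/m`) gives
`m² · Σ B ≤ M · |G| · tr B` (`stub_thetaRectangleCover`).  For the interval, `P = [b, L)`, `Q = [0, b)`
with `b = ⌊s²/2⌋`: every admissible block pair `(A, B)` (`|A| = |B| = s`, direct, `A − B ⊆ X₀`) has
`s²` distinct differences in `[0, L)`, so one of them, `d`, has `b ≤ d ≤ L − b` (only `2b − 1 < s²`
residues are bad), and the `b` translates `t_j = y − j` (`j < b`, `a − y = d`) all contain the pair: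
coverage `≥ b`; and `B − B ⊆ X₀ − X₀ = (−L, L)` with `3L ≤ p` puts `B` inside an arc of length `L`,
so the coverage is `≤ |B − Q| ≤ L + b − 1` (`stub_intervalCoverage`).  Together
(`stub_thetaIntervalBound`): `⌊s²/2⌋² · Σ B ≤ p · (L + ⌊s²/2⌋)` for every feasible kernel — the wall
order `6p/s²` at `L = s²` (numerics `calc/interval_clique.py`: ratio to the wall 1.75–1.9 for
`s = 3, 4`), and below the log threshold `p / (s (log s)^c)` whenever `L ≤ s³ / (5 (log s)^c)`.
Long intervals (`L ≫ s³`) need several rectangles at once (the LP behind `2p/L`) and are left open. -/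

/-- **stub_thetaRectangleCover** (registered milestone, provable now, size S/M): translated-rectangle
clique cover.  Finite abelian `G`, a rectangle `P − Q ⊆ X₀`, a symmetric PSD entrywise-nonnegative
kernel `B` on block pairs whose nonzero entries sit on equal-or-compatible pairs.  If every vertex `v`
of the diagonal support meets between `m ≥ 1` and `M` of the translated rectangles — i.e. the number of
`t : G` with `v.1 ∩ (t +ᵥ P) ≠ ∅` and `v.2 ∩ (t +ᵥ Q) ≠ ∅` lies in `[m, M]` — then
`m² · Σ_{v,w} B v w ≤ M · |G| · Σ_v B v v`.  Proof: `CliqueCover.value_le_of_cliqueCover` with the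
`|G|` cliques `C_t` (cliques by `Rectangle.entry_eq_zero_of_rectangle`, as `(t + P) − (t + Q) = P − Q`),
weights `y_t = 1/m`, multiplicity `μ = M/m`. -/
theorem stub_thetaRectangleCover :
    ∀ (G : Type) [AddCommGroup G] [Fintype G] [DecidableEq G] (X₀ P Q : Finset G)
      (B : Finset G × Finset G → Finset G × Finset G → ℝ) (m M : ℕ), 0 < m →
      P - Q ⊆ X₀ →
      (∀ v w, B v w = B w v) →
      (∀ x : Finset G × Finset G → ℝ, 0 ≤ ∑ v, ∑ w, x v * B v w * x w) →
      (∀ v w, 0 ≤ B v w) →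
      (∀ v w : Finset G × Finset G, B v w ≠ 0 →
        v = w ∨ (Disjoint (v.1 - w.2) X₀ ∧ Disjoint (w.1 - v.2) X₀)) →
      (∀ v : Finset G × Finset G, B v v ≠ 0 →
        m ≤ (Finset.univ.filter fun t : G =>
              (v.1 ∩ (t +ᵥ P)).Nonempty ∧ (v.2 ∩ (t +ᵥ Q)).Nonempty).card) →
      (∀ v : Finset G × Finset G, B v v ≠ 0 →
        (Finset.univ.filter fun t : G =>
              (v.1 ∩ (t +ᵥ P)).Nonempty ∧ (v.2 ∩ (t +ᵥ Q)).Nonempty).card ≤ M) →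
      (m : ℝ) ^ 2 * ∑ v, ∑ w, B v w ≤ (M : ℝ) * (Fintype.card G : ℝ) * ∑ v, B v v := by
  exact _root_.Summit.MatrixMultiplication.MatrixMultiplication.Theorems.PrimeLogDecayTheta.RectangleCover.stub_thetaRectangleCover

/-- **stub_intervalCoverage** (registered milestone, provable now, size M; pure additive
combinatorics in `ℤ/p`, no kernels): for the interval `X₀ = {0, …, L−1}` (as residues), `2 ≤ s`,
`s² ≤ L`, `3L ≤ p`, and the rectangle `P = [b, L)`, `Q = [0, b)` with `b = ⌊s²/2⌋`, every admissible
block pair `(A, B)` — `|A| = |B| = s`, direct (clause (W)), `A − B ⊆ X₀` — is contained in AT LEAST `b`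
and AT MOST `L + b` of the translated rectangle cliques, i.e.
`b ≤ #{t : A ∩ (t + P) ≠ ∅ ∧ B ∩ (t + Q) ≠ ∅} ≤ L + b`.  Lower bound: the `s²` differences `a − y`
are distinct residues of `[0, L)`; at most `2b − 1 < s²` of those residues have `d < b` or `d > L − b`,
so some `a − y = d` with `b ≤ d ≤ L − b`, and then `t_j := y − j` for `j < b` works (`y = t_j + j ∈
t_j + Q`, `a = t_j + (j + d) ∈ t_j + P` as `b ≤ j + d ≤ L − 1`); the `t_j` are distinct since `b < p`.
Upper bound: `t ↦` "`B` meets `t + Q`" already forces `t ∈ B − Q`; and `B − B ⊆ X₀ − X₀` (fix `a ∈ A`: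
`y' − y = (a − y) − (a − y')`) consists of residues of integers in `(−L, L)`, which with `3L ≤ p` puts
`B` inside an arc `c + {0, …, L−1}` (take `c ∈ B` whose integer offset from a base point is minimal),
whence `B − Q ⊆ c + {−(b−1), …, L−1}` has at most `L + b − 1` elements. -/
theorem stub_intervalCoverage :
    ∀ (p : ℕ) [Fact p.Prime] (s L : ℕ), 2 ≤ s → s ^ 2 ≤ L → 3 * L ≤ p →
      ∀ (A B : Finset (ZMod p)), A.card = s → B.card = s →
      (∀ a ∈ A, ∀ a' ∈ A, ∀ b ∈ B, ∀ b' ∈ B, (a - a') + (b - b') = 0 → a = a' ∧ b = b') →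
      A - B ⊆ (Finset.range L).image (Nat.cast : ℕ → ZMod p) →
      s ^ 2 / 2 ≤ (Finset.univ.filter fun t : ZMod p =>
          (A ∩ (t +ᵥ (Finset.Ico (s ^ 2 / 2) L).image (Nat.cast : ℕ → ZMod p))).Nonempty ∧
          (B ∩ (t +ᵥ (Finset.range (s ^ 2 / 2)).image (Nat.cast : ℕ → ZMod p))).Nonempty).card ∧
      (Finset.univ.filter fun t : ZMod p =>
          (A ∩ (t +ᵥ (Finset.Ico (s ^ 2 / 2) L).image (Nat.cast : ℕ → ZMod p))).Nonempty ∧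
          (B ∩ (t +ᵥ (Finset.range (s ^ 2 / 2)).image (Nat.cast : ℕ → ZMod p))).Nonempty).card
        ≤ L + s ^ 2 / 2 := by
  exact _root_.Summit.MatrixMultiplication.MatrixMultiplication.Theorems.PrimeLogDecayTheta.IntervalCoverage.stub_intervalCoverage

/-- The interval rectangle: `[b, L) − [0, b) ⊆ [0, L)` as residues of `ℤ/p`. -/
theorem ico_sub_range_subset (p b L : ℕ) :
    (Finset.Ico b L).image (Nat.cast : ℕ → ZMod p) - (Finset.range b).image (Nat.cast : ℕ → ZMod p)
      ⊆ (Finset.range L).image (Nat.cast : ℕ → ZMod p) := by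
  intro x hx
  rw [Finset.mem_sub] at hx
  obtain ⟨u, hu, v, hv, rfl⟩ := hx
  rw [Finset.mem_image] at hu hv ⊢
  obtain ⟨i, hi, rfl⟩ := hu
  obtain ⟨j, hj, rfl⟩ := hv
  rw [Finset.mem_Ico] at hi
  rw [Finset.mem_range] at hj
  refine ⟨i - j, Finset.mem_range.2 (by omega), ?_⟩
  rw [Nat.cast_sub (by omega)]

/-- **stub_thetaIntervalBound** (registered milestone, PROVED here from the two stubs above;
the bet's conclusion on INTERVAL frozen sets, at wall order): for `2 ≤ s`, `s² ≤ L`, `3L ≤ p` and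
`X₀ = {0, …, L−1} ⊆ ℤ/p`, every symmetric PSD entrywise-nonnegative trace-one kernel supported on
admissible-compatible pairs (the bet's support hypothesis with this `X₀`) satisfies
`⌊s²/2⌋² · Σ_{v,w} B v w ≤ p · (L + ⌊s²/2⌋)`; in particular its value is `≤ (4L + 2s²) p / (s² − 1)²`,
which is `≤ p / (s (log s)^c)` as soon as `L ≤ s³ / (5 (log s)^c)` and `s` is large.  Translation
invariance and diagonal dominance are not needed. -/
theorem stub_thetaIntervalBound :
    ∀ (p : ℕ) [Fact p.Prime] (s L : ℕ), 2 ≤ s → s ^ 2 ≤ L → 3 * L ≤ p →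
      ∀ B : Finset (ZMod p) × Finset (ZMod p) → Finset (ZMod p) × Finset (ZMod p) → ℝ,
      (∀ v w, B v w = B w v) →
      (∀ x : Finset (ZMod p) × Finset (ZMod p) → ℝ, 0 ≤ ∑ v, ∑ w, x v * B v w * x w) →
      (∀ v w, 0 ≤ B v w) →
      (∀ v w : Finset (ZMod p) × Finset (ZMod p), B v w ≠ 0 →
        (v.1.card = s ∧ v.2.card = s ∧
          (∀ a ∈ v.1, ∀ a' ∈ v.1, ∀ b ∈ v.2, ∀ b' ∈ v.2, (a - a') + (b - b') = 0 → a = a' ∧ b = b') ∧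
          v.1 - v.2 ⊆ (Finset.range L).image (Nat.cast : ℕ → ZMod p)) ∧
        (w.1.card = s ∧ w.2.card = s ∧
          (∀ a ∈ w.1, ∀ a' ∈ w.1, ∀ b ∈ w.2, ∀ b' ∈ w.2, (a - a') + (b - b') = 0 → a = a' ∧ b = b') ∧
          w.1 - w.2 ⊆ (Finset.range L).image (Nat.cast : ℕ → ZMod p)) ∧
        (v = w ∨ (Disjoint (v.1 - w.2) ((Finset.range L).image (Nat.cast : ℕ → ZMod p)) ∧
          Disjoint (w.1 - v.2) ((Finset.range L).image (Nat.cast : ℕ → ZMod p))))) →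
      ∑ v, B v v = 1 →
      ((s ^ 2 / 2 : ℕ) : ℝ) ^ 2 * ∑ v, ∑ w, B v w ≤ (p : ℝ) * ((L : ℝ) + ((s ^ 2 / 2 : ℕ) : ℝ)) := by
  intro p _ s L hs hsL hLp B hsymm hpsd hnn hsupp htr
  have hm : 0 < s ^ 2 / 2 := by
    have h4 : 4 ≤ s ^ 2 := by nlinarith
    omega
  have key := stub_thetaRectangleCover (ZMod p) ((Finset.range L).image (Nat.cast : ℕ → ZMod p))
    ((Finset.Ico (s ^ 2 / 2) L).image (Nat.cast : ℕ → ZMod p))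
    ((Finset.range (s ^ 2 / 2)).image (Nat.cast : ℕ → ZMod p)) B (s ^ 2 / 2) (L + s ^ 2 / 2) hm
    (ico_sub_range_subset p _ _) hsymm hpsd hnn (fun v w h => (hsupp v w h).2.2)
    (fun v hv => (stub_intervalCoverage p s L hs hsL hLp v.1 v.2 (hsupp v v hv).1.1
      (hsupp v v hv).1.2.1 (hsupp v v hv).1.2.2.1 (hsupp v v hv).1.2.2.2).1)
    (fun v hv => (stub_intervalCoverage p s L hs hsL hLp v.1 v.2 (hsupp v v hv).1.1
      (hsupp v v hv).1.2.1 (hsupp v v hv).1.2.2.1 (hsupp v v hv).1.2.2.2).2)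
  rw [htr, ZMod.card p, mul_one] at key
  have e : ((L + s ^ 2 / 2 : ℕ) : ℝ) * (p : ℝ) = (p : ℝ) * ((L : ℝ) + ((s ^ 2 / 2 : ℕ) : ℝ)) := by
    push_cast
    ring
  linarith [key, e]

/-- **stub_thetaCommonSide** (registered milestone, lead cycle 1, provable now, size S/M): the
COMMON-SIDE clique.  Finite abelian `G`; `B` a symmetric PSD entrywise-nonnegative kernel on block
pairs whose nonzero entries sit on admissible equal-or-compatible pairs (the bet's support hypothesis
verbatim, `G` for `ZMod p`); every vertex of the diagonal support has `A`-side a translate of ONE fixed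
set `A₀` (its `B`-side is arbitrary).  Then `s² · Σ_{v,w} B v w ≤ |G| · Σ_v B v v` — a whole
common-`A`-side class obeys the single-shape wall `|G|/s²`.  Mechanism: if `v.1 = x + A₀`,
`c + a ∈ v.2`, `c + a' ∈ w.2` (`a, a' ∈ A₀`) then `(x + a') − (c + a') = x − c = (x + a) − (c + a) ∈
v.1 − v.2 ⊆ X₀`, so `v.1 − w.2` meets `X₀` and `v ≠ w` are incompatible: the support vertices whose
`B`-side meets `c + A₀` form a clique, each support vertex lies in exactly `|v.2 − A₀| = s²` of these
`|G|` cliques (directness), and `CliqueCover.value_le_of_cliqueCover` (weights `1/s²`, `μ = 1`)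
concludes.  This kills the "mixed / row shapes" of sumset worlds `X₀ = (A₀ − B₀) + U` that escape
rectangle and skew cliques (crux NOTES rev 4, §3). -/
theorem stub_thetaCommonSide :
    ∀ (G : Type) [AddCommGroup G] [Fintype G] [DecidableEq G] (s : ℕ) (X₀ A₀ : Finset G)
      (B : Finset G × Finset G → Finset G × Finset G → ℝ),
      (∀ v w, B v w = B w v) →
      (∀ x : Finset G × Finset G → ℝ, 0 ≤ ∑ v, ∑ w, x v * B v w * x w) →
      (∀ v w, 0 ≤ B v w) →
      (∀ v w : Finset G × Finset G, B v w ≠ 0 →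
        (v.1.card = s ∧ v.2.card = s ∧
          (∀ a ∈ v.1, ∀ a' ∈ v.1, ∀ b ∈ v.2, ∀ b' ∈ v.2, (a - a') + (b - b') = 0 → a = a' ∧ b = b') ∧
          v.1 - v.2 ⊆ X₀) ∧
        (w.1.card = s ∧ w.2.card = s ∧
          (∀ a ∈ w.1, ∀ a' ∈ w.1, ∀ b ∈ w.2, ∀ b' ∈ w.2, (a - a') + (b - b') = 0 → a = a' ∧ b = b') ∧
          w.1 - w.2 ⊆ X₀) ∧
        (v = w ∨ (Disjoint (v.1 - w.2) X₀ ∧ Disjoint (w.1 - v.2) X₀))) →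
      (∀ v : Finset G × Finset G, B v v ≠ 0 → ∃ x : G, v.1 = x +ᵥ A₀) →
      (s : ℝ) ^ 2 * ∑ v, ∑ w, B v w ≤ (Fintype.card G : ℝ) * ∑ v, B v v := by
  sorry

/-- **stub_thetaCommonSideClasses** (registered milestone, lead cycle 2, provable now, size M): several
common-side classes at once.  If every vertex of the diagonal support has its `A`-side a translate of a member
of `SA` or its `B`-side a translate of a member of `SB`, then `s² · Σ B ≤ (|SA| + |SB|) · |G| · tr B` — contains
`stub_thetaCommonSide` (`SA = {A₀}`, `SB = ∅`) and the sibling's ShapeCount (`K` shapes are `K` classes); with it,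
sumset worlds `X₀ = (A₀ − B₀) + U` (generic tile, `|U| = s`: six classes) are `O(p/s²)`.  Mechanism: assign each
support vertex ONE class; cliques "same class `σ`, free side meets `c +ᵥ σ`"; exact coverage `s²`;
`CliqueCover.value_le_of_cliqueCover` with weights `1/s²` on the `(|SA| + |SB|)·|G|` relevant cliques. -/
theorem stub_thetaCommonSideClasses :
    ∀ (G : Type) [AddCommGroup G] [Fintype G] [DecidableEq G] (s : ℕ) (X₀ : Finset G)
      (SA SB : Finset (Finset G)) (B : Finset G × Finset G → Finset G × Finset G → ℝ),
      (∀ v w, B v w = B w v) →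
      (∀ x : Finset G × Finset G → ℝ, 0 ≤ ∑ v, ∑ w, x v * B v w * x w) →
      (∀ v w, 0 ≤ B v w) →
      (∀ v w : Finset G × Finset G, B v w ≠ 0 →
        (v.1.card = s ∧ v.2.card = s ∧
          (∀ a ∈ v.1, ∀ a' ∈ v.1, ∀ b ∈ v.2, ∀ b' ∈ v.2, (a - a') + (b - b') = 0 → a = a' ∧ b = b') ∧
          v.1 - v.2 ⊆ X₀) ∧
        (w.1.card = s ∧ w.2.card = s ∧
          (∀ a ∈ w.1, ∀ a' ∈ w.1, ∀ b ∈ w.2, ∀ b' ∈ w.2, (a - a') + (b - b') = 0 → a = a' ∧ b = b') ∧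
          w.1 - w.2 ⊆ X₀) ∧
        (v = w ∨ (Disjoint (v.1 - w.2) X₀ ∧ Disjoint (w.1 - v.2) X₀))) →
      (∀ v : Finset G × Finset G, B v v ≠ 0 →
        (∃ A₀ ∈ SA, ∃ x : G, v.1 = x +ᵥ A₀) ∨ (∃ B₀ ∈ SB, ∃ x : G, v.2 = x +ᵥ B₀)) →
      (s : ℝ) ^ 2 * ∑ v, ∑ w, B v w ≤
        ((SA.card : ℝ) + (SB.card : ℝ)) * (Fintype.card G : ℝ) * ∑ v, B v v := by
  sorry

/-! ## Proved glue (i): the SDPP family is a set of pairwise compatible vertices of `G_Δ` -/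

/-- Clause (X) says the cross differences `A i − B k` (`i ≠ k`) avoid the matched difference set
`Δ = ⋃ⱼ (A j − B j)` (the card's PairwiseForm / F0). -/
theorem cross_disjoint {p n : ℕ} (A B : Fin n → Finset (ZMod p))
    (hX : ∀ i j k : Fin n, ∀ a ∈ A i, ∀ a' ∈ A j, ∀ b ∈ B j, ∀ b' ∈ B k,
      (a - a') + (b - b') = 0 → i = k)
    {i k : Fin n} (hik : i ≠ k) :
    Disjoint (A i - B k) (Finset.univ.biUnion fun j => A j - B j) := by
  rw [Finset.disjoint_left]
  intro x hx hx'
  rw [Finset.mem_sub] at hx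
  obtain ⟨a, ha, b', hb', rfl⟩ := hx
  rw [Finset.mem_biUnion] at hx'
  obtain ⟨j, -, hj⟩ := hx'
  rw [Finset.mem_sub] at hj
  obtain ⟨a', ha', b, hb, h⟩ := hj
  have h0 : (a - a') + (b - b') = 0 := by
    linear_combination -h
  exact hik (hX i j k a ha a' ha' b hb b' hb' h0)

/-- Distinct indices carry distinct blocks (from (X) with `j = k` and non-emptiness). -/
theorem blocks_injective {p n s : ℕ} (A B : Fin n → Finset (ZMod p)) (hs : 1 ≤ s)
    (hcard : ∀ i : Fin n, (A i).card = s ∧ (B i).card = s)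
    (hX : ∀ i j k : Fin n, ∀ a ∈ A i, ∀ a' ∈ A j, ∀ b ∈ B j, ∀ b' ∈ B k,
      (a - a') + (b - b') = 0 → i = k) :
    Function.Injective (fun i => (A i, B i)) := by
  intro i k hik
  simp only [Prod.mk.injEq] at hik
  obtain ⟨hA, hB⟩ := hik
  have hneA : (A i).Nonempty := by
    rw [← Finset.card_pos]; have := (hcard i).1; omega
  have hneB : (B i).Nonempty := by
    rw [← Finset.card_pos]; have := (hcard i).2; omega
  obtain ⟨a, ha⟩ := hneA
  obtain ⟨b, hb⟩ := hneB
  exact hX i k k a ha a (hA ▸ ha) b (hB ▸ hb) b (hB ▸ hb) (by simp)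

/-! ## Proved glue (ii): admissibility and compatibility are translation invariant -/

section Invariance

variable {p : ℕ}

/-- clause (W) for a block is invariant under translating both sides by `t`. -/
theorem dpp_vadd_iff (t : ZMod p) (A B : Finset (ZMod p)) :
    (∀ a ∈ t +ᵥ A, ∀ a' ∈ t +ᵥ A, ∀ b ∈ t +ᵥ B, ∀ b' ∈ t +ᵥ B,
        (a - a') + (b - b') = 0 → a = a' ∧ b = b') ↔
    (∀ a ∈ A, ∀ a' ∈ A, ∀ b ∈ B, ∀ b' ∈ B, (a - a') + (b - b') = 0 → a = a' ∧ b = b') := by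
  constructor
  · intro h a ha a' ha' b hb b' hb' h0
    have h1 := h (t +ᵥ a) ((Finset.vadd_mem_vadd_finset_iff t).mpr ha) (t +ᵥ a')
      ((Finset.vadd_mem_vadd_finset_iff t).mpr ha') (t +ᵥ b)
      ((Finset.vadd_mem_vadd_finset_iff t).mpr hb)
      (t +ᵥ b') ((Finset.vadd_mem_vadd_finset_iff t).mpr hb')
      (by simp only [vadd_eq_add]; linear_combination h0)
    simp only [vadd_eq_add, add_right_inj] at h1
    exact h1
  · intro h x hx x' hx' y hy y' hy' h0
    rw [Finset.mem_vadd_finset] at hx hx' hy hy'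
    obtain ⟨a, ha, rfl⟩ := hx
    obtain ⟨a', ha', rfl⟩ := hx'
    obtain ⟨b, hb, rfl⟩ := hy
    obtain ⟨b', hb', rfl⟩ := hy'
    have h1 := h a ha a' ha' b hb b' hb'
      (by simp only [vadd_eq_add] at h0; linear_combination h0)
    obtain ⟨rfl, rfl⟩ := h1
    exact ⟨rfl, rfl⟩

/-- difference sets are invariant: `(t +ᵥ A) − (t +ᵥ B) = A − B`. -/
theorem vadd_sub_vadd (t : ZMod p) (A B : Finset (ZMod p)) :
    (t +ᵥ A) - (t +ᵥ B) = A - B := by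
  ext x
  simp only [Finset.mem_sub, Finset.mem_vadd_finset]
  constructor
  · rintro ⟨_, ⟨a, ha, rfl⟩, _, ⟨b, hb, rfl⟩, rfl⟩
    exact ⟨a, ha, b, hb, by simp only [vadd_eq_add]; abel⟩
  · rintro ⟨a, ha, b, hb, rfl⟩
    exact ⟨t +ᵥ a, ⟨a, ha, rfl⟩, t +ᵥ b, ⟨b, hb, rfl⟩, by simp only [vadd_eq_add]; abel⟩

/-- admissibility of a vertex `v = (A, B)` for `X₀` is translation invariant. -/
theorem adm_vadd_iff (s : ℕ) (X₀ : Finset (ZMod p)) (t : ZMod p)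
    (v : Finset (ZMod p) × Finset (ZMod p)) :
    ((t +ᵥ v).1.card = s ∧ (t +ᵥ v).2.card = s ∧
        (∀ a ∈ (t +ᵥ v).1, ∀ a' ∈ (t +ᵥ v).1, ∀ b ∈ (t +ᵥ v).2, ∀ b' ∈ (t +ᵥ v).2,
            (a - a') + (b - b') = 0 → a = a' ∧ b = b') ∧
        (t +ᵥ v).1 - (t +ᵥ v).2 ⊆ X₀) ↔
    (v.1.card = s ∧ v.2.card = s ∧
        (∀ a ∈ v.1, ∀ a' ∈ v.1, ∀ b ∈ v.2, ∀ b' ∈ v.2,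
            (a - a') + (b - b') = 0 → a = a' ∧ b = b') ∧
        v.1 - v.2 ⊆ X₀) := by
  rw [Prod.vadd_fst, Prod.vadd_snd, Finset.card_vadd_finset, Finset.card_vadd_finset,
    dpp_vadd_iff, vadd_sub_vadd]

/-- compatibility of two vertices is translation invariant. -/
theorem compat_vadd_iff (X₀ : Finset (ZMod p)) (t : ZMod p)
    (v w : Finset (ZMod p) × Finset (ZMod p)) :
    (t +ᵥ v = t +ᵥ w ∨
        (Disjoint ((t +ᵥ v).1 - (t +ᵥ w).2) X₀ ∧ Disjoint ((t +ᵥ w).1 - (t +ᵥ v).2) X₀)) ↔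
    (v = w ∨ (Disjoint (v.1 - w.2) X₀ ∧ Disjoint (w.1 - v.2) X₀)) := by
  rw [Prod.vadd_fst, Prod.vadd_snd, Prod.vadd_fst, Prod.vadd_snd, vadd_sub_vadd, vadd_sub_vadd,
    (AddAction.injective t).eq_iff]

/-- the whole support predicate of the relaxation is translation invariant. -/
theorem support_vadd_iff (s : ℕ) (X₀ : Finset (ZMod p)) (t : ZMod p)
    (v w : Finset (ZMod p) × Finset (ZMod p)) :
    ((((t +ᵥ v).1.card = s ∧ (t +ᵥ v).2.card = s ∧
          (∀ a ∈ (t +ᵥ v).1, ∀ a' ∈ (t +ᵥ v).1, ∀ b ∈ (t +ᵥ v).2, ∀ b' ∈ (t +ᵥ v).2,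
              (a - a') + (b - b') = 0 → a = a' ∧ b = b') ∧
          (t +ᵥ v).1 - (t +ᵥ v).2 ⊆ X₀) ∧
        ((t +ᵥ w).1.card = s ∧ (t +ᵥ w).2.card = s ∧
          (∀ a ∈ (t +ᵥ w).1, ∀ a' ∈ (t +ᵥ w).1, ∀ b ∈ (t +ᵥ w).2, ∀ b' ∈ (t +ᵥ w).2,
              (a - a') + (b - b') = 0 → a = a' ∧ b = b') ∧
          (t +ᵥ w).1 - (t +ᵥ w).2 ⊆ X₀) ∧
        (t +ᵥ v = t +ᵥ w ∨
          (Disjoint ((t +ᵥ v).1 - (t +ᵥ w).2) X₀ ∧ Disjoint ((t +ᵥ w).1 - (t +ᵥ v).2) X₀))) ↔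
      ((v.1.card = s ∧ v.2.card = s ∧
          (∀ a ∈ v.1, ∀ a' ∈ v.1, ∀ b ∈ v.2, ∀ b' ∈ v.2,
              (a - a') + (b - b') = 0 → a = a' ∧ b = b') ∧
          v.1 - v.2 ⊆ X₀) ∧
        (w.1.card = s ∧ w.2.card = s ∧
          (∀ a ∈ w.1, ∀ a' ∈ w.1, ∀ b ∈ w.2, ∀ b' ∈ w.2,
              (a - a') + (b - b') = 0 → a = a' ∧ b = b') ∧
          w.1 - w.2 ⊆ X₀) ∧
        (v = w ∨ (Disjoint (v.1 - w.2) X₀ ∧ Disjoint (w.1 - v.2) X₀)))) := by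
  rw [adm_vadd_iff, adm_vadd_iff, compat_vadd_iff]

end Invariance

/-! ## The composition (kernel-checked modulo the stubs) -/

/-- **The composition** (kernel-checked modulo the stubs; its conditional form `bet → PrimeLogDecay`
is landed separately as `Theorems/FourierTwoFamiliesModPPrimeLogDecayOfThetaLogBound.lean`).
`stub_thetaDegreeOne → stub_thetaFrequencyBias → stub_thetaLogBoundNoCert → PrimeLogDecay`: with
`X₀ := Δ = ⋃ⱼ (A j − B j)` the family `{(A i, B i)}` is a set of `n` pairwise-compatible admissible
vertices; every invariant feasible kernel has value `≤ p/(s (log s)^c)` (uniform branch by a degree-one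
certificate, structured branch by the bet), hence every feasible kernel (`stub_average`, landed) and the
family point (`stub_familyPoint`, landed): `n·s·(log s)^c ≤ p`. -/
theorem PrimeLogDecay_of : PrimeLogDecay := by
  obtain ⟨c, hc, s₀, hbet⟩ := stub_thetaLogBoundNoCert
  refine ⟨c, hc, max s₀ 2, ?_⟩
  intro p hp n s A B hs hcard hW hX
  haveI : Fact p.Prime := ⟨hp⟩
  have hs₀ : s₀ ≤ s := le_trans (le_max_left _ _) hs
  have hs2 : 2 ≤ s := le_trans (le_max_right _ _) hs
  have hs1 : 1 ≤ s := le_trans (by norm_num) hs2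
  have hsR : (0 : ℝ) < s := by exact_mod_cast (show 0 < s by omega)
  have hlog : 0 < Real.log (s : ℝ) := Real.log_pos (by exact_mod_cast (show 1 < s by omega))
  have hLpos : 0 < Real.log (s : ℝ) ^ c := Real.rpow_pos_of_pos hlog c
  have hsL : 0 < (s : ℝ) * Real.log (s : ℝ) ^ c := mul_pos hsR hLpos
  have hTnn : 0 ≤ (p : ℝ) / ((s : ℝ) * Real.log (s : ℝ) ^ c) :=
    div_nonneg (Nat.cast_nonneg _) hsL.le
  -- Step 1: every translation-invariant feasible kernel on `G_Δ` has value `≤ p / (s (log s)^c)`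
  have hinv : ∀ Bk : Finset (ZMod p) × Finset (ZMod p) → Finset (ZMod p) × Finset (ZMod p) → ℝ,
      (∀ (t : ZMod p) (v w : Finset (ZMod p) × Finset (ZMod p)), Bk (t +ᵥ v) (t +ᵥ w) = Bk v w) →
      (∀ v w, Bk v w = Bk w v) →
      (∀ x : Finset (ZMod p) × Finset (ZMod p) → ℝ, 0 ≤ ∑ v, ∑ w, x v * Bk v w * x w) →
      (∀ v w, 0 ≤ Bk v w) →
      (∀ v w, Bk v w ≤ Bk v v) →
      (∀ v w : Finset (ZMod p) × Finset (ZMod p), Bk v w ≠ 0 →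
          (v.1.card = s ∧ v.2.card = s ∧
            (∀ a ∈ v.1, ∀ a' ∈ v.1, ∀ b ∈ v.2, ∀ b' ∈ v.2,
                (a - a') + (b - b') = 0 → a = a' ∧ b = b') ∧
            v.1 - v.2 ⊆ Finset.univ.biUnion fun j => A j - B j) ∧
          (w.1.card = s ∧ w.2.card = s ∧
            (∀ a ∈ w.1, ∀ a' ∈ w.1, ∀ b ∈ w.2, ∀ b' ∈ w.2,
                (a - a') + (b - b') = 0 → a = a' ∧ b = b') ∧
            w.1 - w.2 ⊆ Finset.univ.biUnion fun j => A j - B j) ∧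
          (v = w ∨ (Disjoint (v.1 - w.2) (Finset.univ.biUnion fun j => A j - B j) ∧
            Disjoint (w.1 - v.2) (Finset.univ.biUnion fun j => A j - B j)))) →
      ∑ v, Bk v v = 1 →
      ∑ v, ∑ w, Bk v w ≤ (p : ℝ) / ((s : ℝ) * Real.log (s : ℝ) ^ c) := by
    intro Bk hinvk hsymm hpsd hnn hdom hsupp htr
    have hXnn : 0 ≤ ∑ v, ∑ w, Bk v w :=
      Finset.sum_nonneg fun v _ => Finset.sum_nonneg fun w _ => hnn v w
    rw [le_div_iff₀ hsL]
    by_cases hU : ∃ (F : ZMod p → ℝ) (M : ℝ), 0 ≤ M ∧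
        (∀ x ∈ (Finset.univ.biUnion fun j => A j - B j), F x ≤ 1) ∧
        (∀ x, x ∉ (Finset.univ.biUnion fun j => A j - B j) → F x ≤ 0) ∧
        (∀ ψ : AddChar (ZMod p) ℂ, ψ ≠ 1 → ‖∑ x, (F x : ℂ) * ψ x‖ ≤ M) ∧
        ((s : ℝ) + M) * Real.log (s : ℝ) ^ c ≤ ∑ x, F x
    · -- uniform branch: a degree-one certificate `F` exists
      obtain ⟨F, M, hM, hF1, hF0, hFhat, hqual⟩ := hU
      have h1 := stub_thetaDegreeOne (ZMod p) s hs1 (Finset.univ.biUnion fun j => A j - B j) Bk F M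
        hsymm hpsd hnn hsupp htr hM hF1 hF0 hFhat
      rw [ZMod.card p] at h1
      -- h1 : s·X·ΣF ≤ s·p + M·(p − s·X);  hqual : (s + M)·(log s)^c ≤ ΣF
      have hsM : 0 < (s : ℝ) + M := by linarith
      have hA : (s : ℝ) * (∑ v, ∑ w, Bk v w) * (((s : ℝ) + M) * Real.log (s : ℝ) ^ c) ≤
          (s : ℝ) * (∑ v, ∑ w, Bk v w) * ∑ x, F x :=
        mul_le_mul_of_nonneg_left hqual (mul_nonneg hsR.le hXnn)
      have hB : (s : ℝ) * (∑ v, ∑ w, Bk v w) * (∑ x, F x) ≤ ((s : ℝ) + M) * (p : ℝ) := by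
        have hMsX : 0 ≤ M * ((s : ℝ) * ∑ v, ∑ w, Bk v w) := mul_nonneg hM (mul_nonneg hsR.le hXnn)
        nlinarith [h1, hMsX]
      have hC : ((s : ℝ) + M) * ((∑ v, ∑ w, Bk v w) * ((s : ℝ) * Real.log (s : ℝ) ^ c)) ≤
          ((s : ℝ) + M) * (p : ℝ) := by
        have e : ((s : ℝ) + M) * ((∑ v, ∑ w, Bk v w) * ((s : ℝ) * Real.log (s : ℝ) ^ c)) =
            (s : ℝ) * (∑ v, ∑ w, Bk v w) * (((s : ℝ) + M) * Real.log (s : ℝ) ^ c) := by ring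
        rw [e]
        exact hA.trans hB
      exact le_of_mul_le_mul_left hC hsM
    · -- structured branch (no degree-one certificate): the bet, fed by `ϑ`-FrequencyBias
      push Not at hU
      have h2 : ∀ M : ℝ, 0 ≤ M →
          (∀ ψ : AddChar (ZMod p) ℂ, ψ ≠ 1 →
            ‖∑ v, (Bk v v : ℂ) * ∑ a ∈ v.1, ∑ b ∈ v.2, ψ (a - b)‖ ≤ M) →
          (s : ℝ) ^ 2 * ((s : ℝ) ^ 2 * (∑ v, ∑ w, Bk v w) - (p : ℝ)) ≤
            M * ((p : ℝ) * (s : ℝ) - (s : ℝ) ^ 2 * ∑ v, ∑ w, Bk v w) := by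
        intro M hM hMb
        have h := stub_thetaFrequencyBias (ZMod p) s hs1 (Finset.univ.biUnion fun j => A j - B j)
          Bk M hsymm hpsd hsupp htr hM hMb
        rwa [ZMod.card p] at h
      have key := hbet p s hs₀ (Finset.univ.biUnion fun j => A j - B j) hU Bk hinvk hsymm hpsd hnn
        hdom hsupp htr h2
      calc (∑ v, ∑ w, Bk v w) * ((s : ℝ) * Real.log (s : ℝ) ^ c)
          = (s : ℝ) * Real.log (s : ℝ) ^ c * ∑ v, ∑ w, Bk v w := by ring
        _ ≤ (p : ℝ) := key
  -- Step 2: symmetrisation removes the invariance hypothesis (landed `stub_average`)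
  have key := Average.stub_average p (Finset (ZMod p) × Finset (ZMod p)) _ _
    (fun t v w => support_vadd_iff s (Finset.univ.biUnion fun j => A j - B j) t v w) hinv
  -- Step 3: the family as a finset of pairwise compatible vertices (landed `stub_familyPoint`)
  have hFinj : Function.Injective (fun i => (A i, B i)) := blocks_injective A B hs1 hcard hX
  have hScard : (Finset.univ.image fun i => (A i, B i)).card = n := by
    rw [Finset.card_image_of_injective _ hFinj, Finset.card_univ, Fintype.card_fin]
  have hP : ∀ v ∈ (Finset.univ.image fun i => (A i, B i)),
      ∀ w ∈ (Finset.univ.image fun i => (A i, B i)),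
        ((v.1.card = s ∧ v.2.card = s ∧
            (∀ a ∈ v.1, ∀ a' ∈ v.1, ∀ b ∈ v.2, ∀ b' ∈ v.2,
                (a - a') + (b - b') = 0 → a = a' ∧ b = b') ∧
            v.1 - v.2 ⊆ Finset.univ.biUnion fun j => A j - B j) ∧
          (w.1.card = s ∧ w.2.card = s ∧
            (∀ a ∈ w.1, ∀ a' ∈ w.1, ∀ b ∈ w.2, ∀ b' ∈ w.2,
                (a - a') + (b - b') = 0 → a = a' ∧ b = b') ∧
            w.1 - w.2 ⊆ Finset.univ.biUnion fun j => A j - B j) ∧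
          (v = w ∨ (Disjoint (v.1 - w.2) (Finset.univ.biUnion fun j => A j - B j) ∧
            Disjoint (w.1 - v.2) (Finset.univ.biUnion fun j => A j - B j)))) := by
    intro v hv w hw
    rw [Finset.mem_image] at hv hw
    obtain ⟨i, -, rfl⟩ := hv
    obtain ⟨k, -, rfl⟩ := hw
    refine ⟨⟨(hcard i).1, (hcard i).2, hW i, ?_⟩, ⟨(hcard k).1, (hcard k).2, hW k, ?_⟩, ?_⟩
    · exact Finset.subset_biUnion_of_mem (fun j => A j - B j) (Finset.mem_univ i)
    · exact Finset.subset_biUnion_of_mem (fun j => A j - B j) (Finset.mem_univ k)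
    · by_cases hik : i = k
      · subst hik; exact Or.inl rfl
      · exact Or.inr ⟨cross_disjoint A B hX hik, cross_disjoint A B hX (Ne.symm hik)⟩
  have hn : (n : ℝ) ≤ (p : ℝ) / ((s : ℝ) * Real.log (s : ℝ) ^ c) := by
    have h := FamilyPoint.stub_familyPoint (Finset (ZMod p) × Finset (ZMod p)) _ _ _ hTnn hP key
    rwa [hScard] at h
  have hfin := (le_div_iff₀ hsL).mp hn
  calc (n : ℝ) * (s : ℝ) * Real.log (s : ℝ) ^ c = (n : ℝ) * ((s : ℝ) * Real.log (s : ℝ) ^ c) := by ring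
    _ ≤ (p : ℝ) := hfin

end Summit.MatrixMultiplication.MatrixMultiplication.Cruxes.PrimeLogDecay.FixedDeltaThetaCertificate
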